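import Mathlib
import HarnessLib
import Literature.Analysis.FluidPDE.SelfSimilar
import Summits.NavierStokesRegularity.NavierStokesRegularity.Theorems.PoloidalWindowDoorPoloidalWindowRigidityHotHullSlabUniform
import Summits.NavierStokesRegularity.NavierStokesRegularity.Theorems.PoloidalWindowDoorPoloidalWindowRigidityHotHullCompactness

/-!
# Route `PoloidalWindowDoor`, crux `PoloidalWindowRigidity` (K2, stmt-NavierStokesRegularity-19708) — LINE 23 «eternal_core» (ns-idea-8 g11): SCALING and
# ETERNAL CORES (helper T1 of U2d `ScalingRecurrentCore`), the Cruxes-local `EternalCore` delta-unfolded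

Cell ns-regularity-ideate, seat ns-poloidal-K2-p2 g14 (K2 stub-worker hand, U2d under DIRECTOR-NS #291).  `EternalCore ε₀ R₀ T₀ U` (LINE 23) says: every
backward scale window `[4t₀, t₀]`, `t₀ < T₀`, carries a point `‖y‖ ≤ R₀√(−r)` of the paraboloid with scale-covariant speed `√(−r)‖U r y‖ ≥ ε₀`.  Here:

* `extremal_nsRescale`, `eternalCore_nsRescale` — the extremal bound `√(−t)|U₂| ≤ M` and the eternal core are invariant under the parabolic rescaling
  `nsRescale c` (`c > 0`; the window `t₀` of `nsRescale c U` is the window `c²t₀` of `U`);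
* `tendsto_nsRescale_slices` — rescaling is continuous for slice-wise locally uniform convergence;
* `eternalCore_of_limit` — the eternal core PASSES TO SLICE-WISE LIMITS INSIDE THE CLASS: the window-paraboloid `{(r,y) : r ∈ [4t₀,t₀], ‖y‖ ≤ R₀√(−r)}`
  is compact, the class-uniform KNSS moduli upgrade pointwise convergence to uniform convergence on the enclosing slab
  (`…HotHullSlabUniform.tendstoUniformlyOn_slab`), and the limit profile is jointly continuous there.

WHAT THIS IS NOT: not a claim about Navier–Stokes regularity — scaling bookkeeping for a support of a PASSed files-only line of a door route (bears_on
LADDER-NS N0, rung N0-LocalTubeDoorPoloidal); research cells OPEN; crux 19708 / item 20428 OPEN; NS regularity NOT proved.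
-/

noncomputable section

-- the summit and its single sub-problem share the name (CONVENTIONS §1), as in every Theorems file
set_option linter.dupNamespace false

namespace Summit.NavierStokesRegularity.NavierStokesRegularity.Theorems.PoloidalWindowDoorPoloidalWindowRigidityEternalCoreScalingCore

open Set Function Filter Topology Metric
open scoped InnerProductSpace RealInnerProductSpace NNReal
open Literature.Analysis Literature.Analysis.FluidPDE Literature.Analysis.UnboundedOperators
open Summit.NavierStokesRegularity.NavierStokesRegularity.Theorems
open PoloidalWindowDoorPoloidalWindowRigidityHotHullSlabUniform PoloidalWindowDoorPoloidalWindowRigidityHotHullCompactness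

/-- `√(−c²t) = c√(−t)` for `c ≥ 0`. -/
theorem sqrt_neg_sq_mul {c t : ℝ} (hc : 0 ≤ c) : Real.sqrt (-(c ^ 2 * t)) = c * Real.sqrt (-t) := by
  rw [show -(c ^ 2 * t) = c ^ 2 * (-t) by ring, Real.sqrt_mul (sq_nonneg c), Real.sqrt_sq hc]

/-- **The extremal bound is scale-invariant.** -/
theorem extremal_nsRescale {u : ℝ → EuclideanSpace ℝ (Fin 3) → EuclideanSpace ℝ (Fin 3)} {M : ℝ}
    (h : ∀ t < 0, ∀ x, Real.sqrt (-t) * |u t x 2| ≤ M) {c : ℝ} (hc : 0 < c) :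
    ∀ t < 0, ∀ x, Real.sqrt (-t) * |nsRescale c u t x 2| ≤ M := by
  intro t ht x
  have hct : c ^ 2 * t < 0 := mul_neg_of_pos_of_neg (pow_pos hc 2) ht
  have key := h (c ^ 2 * t) hct (c • x)
  rw [sqrt_neg_sq_mul hc.le] at key
  rw [nsRescale_apply, PiLp.smul_apply, smul_eq_mul, abs_mul, abs_of_pos hc]
  calc Real.sqrt (-t) * (c * |u (c ^ 2 * t) (c • x) 2|) = c * Real.sqrt (-t) * |u (c ^ 2 * t) (c • x) 2| := by ring
    _ ≤ M := key

/-- **The eternal core is scale-covariant**: the window `t₀` of `nsRescale c U` (`c > 0`) is the window `c²t₀` of `U`; `EternalCore` unfolded. -/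
theorem eternalCore_nsRescale {u : ℝ → EuclideanSpace ℝ (Fin 3) → EuclideanSpace ℝ (Fin 3)} {ε₀ R₀ T₀ : ℝ}
    (h : ∀ t₀ : ℝ, t₀ < T₀ → ∃ r ∈ Set.Icc (4 * t₀) t₀, ∃ y : EuclideanSpace ℝ (Fin 3),
      ‖y‖ ≤ R₀ * Real.sqrt (-r) ∧ ε₀ ≤ Real.sqrt (-r) * ‖u r y‖)
    {c : ℝ} (hc : 0 < c) :
    ∀ t₀ : ℝ, c ^ 2 * t₀ < T₀ → ∃ r ∈ Set.Icc (4 * t₀) t₀, ∃ y : EuclideanSpace ℝ (Fin 3),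
      ‖y‖ ≤ R₀ * Real.sqrt (-r) ∧ ε₀ ≤ Real.sqrt (-r) * ‖nsRescale c u r y‖ := by
  intro t₀ ht₀
  have hc2 : 0 < c ^ 2 := pow_pos hc 2
  obtain ⟨r', hr', y', hy', hε⟩ := h (c ^ 2 * t₀) ht₀
  refine ⟨r' / c ^ 2, ⟨?_, ?_⟩, c⁻¹ • y', ?_, ?_⟩
  · rw [le_div_iff₀ hc2]; linarith [hr'.1]
  · rw [div_le_iff₀ hc2]; linarith [hr'.2]
  · have e : Real.sqrt (-r') = c * Real.sqrt (-(r' / c ^ 2)) := by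
      rw [← sqrt_neg_sq_mul hc.le, mul_div_cancel₀ _ hc2.ne']
    rw [norm_smul, norm_inv, Real.norm_eq_abs, abs_of_pos hc]
    rw [e] at hy'
    calc c⁻¹ * ‖y'‖ ≤ c⁻¹ * (R₀ * (c * Real.sqrt (-(r' / c ^ 2)))) := mul_le_mul_of_nonneg_left hy' (by positivity)
      _ = R₀ * Real.sqrt (-(r' / c ^ 2)) := by field_simp
  · have e1 : nsRescale c u (r' / c ^ 2) (c⁻¹ • y') = c • u r' y' := by
      rw [nsRescale_apply, mul_div_cancel₀ _ hc2.ne', smul_inv_smul₀ hc.ne']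
    have e : Real.sqrt (-r') = c * Real.sqrt (-(r' / c ^ 2)) := by
      rw [← sqrt_neg_sq_mul hc.le, mul_div_cancel₀ _ hc2.ne']
    rw [e1, norm_smul, Real.norm_eq_abs, abs_of_pos hc]
    calc ε₀ ≤ Real.sqrt (-r') * ‖u r' y'‖ := hε
      _ = Real.sqrt (-(r' / c ^ 2)) * (c * ‖u r' y'‖) := by rw [e]; ring

/-- **Rescaling is continuous for slice-wise locally uniform convergence.** -/
theorem tendsto_nsRescale_slices {Ws : ℕ → ℝ → EuclideanSpace ℝ (Fin 3) → EuclideanSpace ℝ (Fin 3)}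
    {W : ℝ → EuclideanSpace ℝ (Fin 3) → EuclideanSpace ℝ (Fin 3)}
    (h : ∀ t < 0, TendstoLocallyUniformly (fun j => Ws j t) (W t) atTop) {c : ℝ} (hc : 0 < c) :
    ∀ t < 0, TendstoLocallyUniformly (fun j => nsRescale c (Ws j) t) (nsRescale c W t) atTop := by
  intro t ht
  have hct : c ^ 2 * t < 0 := mul_neg_of_pos_of_neg (pow_pos hc 2) ht
  have h1 := (h (c ^ 2 * t) hct).comp (fun x : EuclideanSpace ℝ (Fin 3) => c • x) (continuous_const_smul c)
  have h2 := ((c • ContinuousLinearMap.id ℝ (EuclideanSpace ℝ (Fin 3))).uniformContinuous).comp_tendstoLocallyUniformly h1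
  have e1 : (fun j => nsRescale c (Ws j) t) =
      fun j => (⇑(c • ContinuousLinearMap.id ℝ (EuclideanSpace ℝ (Fin 3)))) ∘ (Ws j (c ^ 2 * t) ∘ fun x => c • x) := by
    funext j x
    simp [nsRescale_apply]
  have e2 : nsRescale c W t = (⇑(c • ContinuousLinearMap.id ℝ (EuclideanSpace ℝ (Fin 3)))) ∘ (W (c ^ 2 * t) ∘ fun x => c • x) := by
    funext x
    simp [nsRescale_apply]
  rw [e1, e2]
  exact h2

/-- **The eternal core passes to slice-wise limits inside the class** (`EternalCore` unfolded): if class-`C` profiles `Ws j` converge pointwise on the open slab to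
the class-`C` profile `W`, and for every window `t₀ < T₀ ≤ 0` eventually every `Ws j` has an `(ε₀, R₀)`-core point in `[4t₀, t₀]`, then so does `W`. -/
theorem eternalCore_of_limit (C ε₀ R₀ T₀ : ℝ) (hT₀ : T₀ ≤ 0)
    {Ws : ℕ → ℝ → EuclideanSpace ℝ (Fin 3) → EuclideanSpace ℝ (Fin 3)} {W : ℝ → EuclideanSpace ℝ (Fin 3) → EuclideanSpace ℝ (Fin 3)}
    (hWs : ∀ j, IsTypeIAncientMild C (Ws j)) (hW : IsTypeIAncientMild C W)
    (hconv : ∀ t < 0, ∀ x, Tendsto (fun j => Ws j t x) atTop (𝓝 (W t x)))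
    (hcore : ∀ t₀ : ℝ, t₀ < T₀ → ∀ᶠ j in atTop, ∃ r ∈ Set.Icc (4 * t₀) t₀, ∃ y : EuclideanSpace ℝ (Fin 3),
      ‖y‖ ≤ R₀ * Real.sqrt (-r) ∧ ε₀ ≤ Real.sqrt (-r) * ‖Ws j r y‖) :
    ∀ t₀ : ℝ, t₀ < T₀ → ∃ r ∈ Set.Icc (4 * t₀) t₀, ∃ y : EuclideanSpace ℝ (Fin 3),
      ‖y‖ ≤ R₀ * Real.sqrt (-r) ∧ ε₀ ≤ Real.sqrt (-r) * ‖W r y‖ := by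
  intro t₀ ht₀
  have ht₀' : t₀ < 0 := lt_of_lt_of_le ht₀ hT₀
  -- the compact window-paraboloid `Q`
  set Q : Set (ℝ × EuclideanSpace ℝ (Fin 3)) :=
    {p | p.1 ∈ Set.Icc (4 * t₀) t₀ ∧ ‖p.2‖ ≤ R₀ * Real.sqrt (-p.1)} with hQ
  have hQcl : IsClosed Q := by
    rw [hQ, Set.setOf_and]
    refine (isClosed_Icc.preimage continuous_fst).inter ?_
    exact isClosed_le (continuous_norm.comp continuous_snd)
      (continuous_const.mul ((Real.continuous_sqrt.comp (continuous_neg.comp continuous_fst))))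
  have hQsub : Q ⊆ Set.Icc (4 * t₀) t₀ ×ˢ closedBall (0 : EuclideanSpace ℝ (Fin 3)) (|R₀| * Real.sqrt (-(4 * t₀))) := by
    rintro ⟨r, y⟩ ⟨hr, hy⟩
    refine mem_prod.2 ⟨hr, mem_closedBall_zero_iff.2 (hy.trans ?_)⟩
    have h1 : Real.sqrt (-r) ≤ Real.sqrt (-(4 * t₀)) := Real.sqrt_le_sqrt (by linarith [hr.1])
    calc R₀ * Real.sqrt (-r) ≤ |R₀| * Real.sqrt (-r) := mul_le_mul_of_nonneg_right (le_abs_self _) (Real.sqrt_nonneg _)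
      _ ≤ |R₀| * Real.sqrt (-(4 * t₀)) := mul_le_mul_of_nonneg_left h1 (abs_nonneg _)
  have hQc : IsCompact Q := (isCompact_Icc.prod (isCompact_closedBall _ _)).of_isClosed_subset hQcl hQsub
  -- a sequence of core points of `Ws (j + J)` in `Q`
  obtain ⟨J, hJ⟩ := eventually_atTop.1 (hcore t₀ ht₀)
  choose r hr y hy hε using fun j => hJ (j + J) (Nat.le_add_left J j)
  have hpQ : ∀ j, (r j, y j) ∈ Q := fun j => ⟨hr j, hy j⟩
  obtain ⟨p, hpQ', φ, hφ, hp⟩ := hQc.tendsto_subseq hpQ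
  -- an enclosing slab and uniform convergence on it
  obtain ⟨n, hn⟩ := exists_nat_ge (max (max (|R₀| * Real.sqrt (-(4 * t₀))) (-(4 * t₀))) (-t₀)⁻¹)
  have hn2 : (1 : ℝ) ≤ (n : ℝ) + 2 := by have := n.cast_nonneg (α := ℝ); linarith
  have hslabQ : Q ⊆ Set.Icc (-((n : ℝ) + 2)) (-((n : ℝ) + 2)⁻¹) ×ˢ closedBall (0 : EuclideanSpace ℝ (Fin 3)) ((n : ℝ) + 2) := by
    intro q hq
    obtain ⟨hq1, hq2⟩ := mem_prod.1 (hQsub hq)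
    have hA : |R₀| * Real.sqrt (-(4 * t₀)) ≤ (n : ℝ) + 2 := by
      linarith [le_max_left (max (|R₀| * Real.sqrt (-(4 * t₀))) (-(4 * t₀))) (-t₀)⁻¹, le_max_left (|R₀| * Real.sqrt (-(4 * t₀))) (-(4 * t₀))]
    have hB : -(4 * t₀) ≤ (n : ℝ) + 2 := by
      linarith [le_max_left (max (|R₀| * Real.sqrt (-(4 * t₀))) (-(4 * t₀))) (-t₀)⁻¹, le_max_right (|R₀| * Real.sqrt (-(4 * t₀))) (-(4 * t₀))]
    have hC' : (-t₀)⁻¹ ≤ (n : ℝ) + 2 := by linarith [le_max_right (max (|R₀| * Real.sqrt (-(4 * t₀))) (-(4 * t₀))) (-t₀)⁻¹]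
    have hC : ((n : ℝ) + 2)⁻¹ ≤ -t₀ := inv_le_of_inv_le₀ (by linarith) hC'
    refine mem_prod.2 ⟨⟨by linarith [hq1.1], by linarith [hq1.2]⟩, closedBall_subset_closedBall hA hq2⟩
  have hslab := tendstoUniformlyOn_slab C (u := Ws) (U := W) (fun j => (hWs j).hasTypeITimeDecay) (fun j => (hWs j).continuousOn_uncurry)
    (fun j s t hst ht x => (hWs j).mild_eq_heatExtension hst ht x) (fun j t ht => (hWs j).isDivFree ht) hW.hasTypeITimeDecay
    hW.continuousOn_uncurry (fun s t hst ht x => hW.mild_eq_heatExtension hst ht x) (fun t ht => hW.isDivFree ht) hconv hn2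
  have hψ : Tendsto (fun k => φ k + J) atTop atTop := tendsto_atTop_mono (fun k => Nat.le_add_right (φ k) J) hφ.tendsto_atTop
  have hslab' : TendstoUniformlyOn (fun k (q : ℝ × EuclideanSpace ℝ (Fin 3)) => Ws (φ k + J) q.1 q.2) (uncurry W) atTop
      (Set.Icc (-((n : ℝ) + 2)) (-((n : ℝ) + 2)⁻¹) ×ˢ closedBall (0 : EuclideanSpace ℝ (Fin 3)) ((n : ℝ) + 2)) := by
    rw [Metric.tendstoUniformlyOn_iff]
    intro ε hε
    exact hψ.eventually (Metric.tendstoUniformlyOn_iff.1 hslab ε hε)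
  -- joint continuity of `W` on the slab
  have hWc : ContinuousWithinAt (uncurry W) (Set.Icc (-((n : ℝ) + 2)) (-((n : ℝ) + 2)⁻¹) ×ˢ closedBall (0 : EuclideanSpace ℝ (Fin 3)) ((n : ℝ) + 2)) p := by
    refine (hW.continuousOn_uncurry.mono ?_).continuousWithinAt (hslabQ hpQ')
    intro q hq
    have h1 := (mem_prod.1 hq).1.2
    have h2 : (0 : ℝ) < ((n : ℝ) + 2)⁻¹ := by positivity
    exact mem_prod.2 ⟨show q.1 < 0 by linarith, mem_univ _⟩
  -- the values at the core points converge
  have hpt : Tendsto (fun k => ((r (φ k), y (φ k)) : ℝ × EuclideanSpace ℝ (Fin 3))) atTop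
      (𝓝[Set.Icc (-((n : ℝ) + 2)) (-((n : ℝ) + 2)⁻¹) ×ˢ closedBall (0 : EuclideanSpace ℝ (Fin 3)) ((n : ℝ) + 2)] p) :=
    tendsto_nhdsWithin_iff.2 ⟨hp, Eventually.of_forall fun k => hslabQ (hpQ (φ k))⟩
  have hval : Tendsto (fun k => Ws (φ k + J) (r (φ k)) (y (φ k))) atTop (𝓝 (W p.1 p.2)) := hslab'.tendsto_comp hWc hpt
  have hsq : Tendsto (fun k => Real.sqrt (-(r (φ k)))) atTop (𝓝 (Real.sqrt (-p.1))) :=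
    ((Real.continuous_sqrt.comp continuous_neg).tendsto _).comp ((continuous_fst.tendsto _).comp hp)
  have hlim : Tendsto (fun k => Real.sqrt (-(r (φ k))) * ‖Ws (φ k + J) (r (φ k)) (y (φ k))‖) atTop (𝓝 (Real.sqrt (-p.1) * ‖W p.1 p.2‖)) :=
    hsq.mul ((continuous_norm.tendsto _).comp hval)
  refine ⟨p.1, hpQ'.1, p.2, hpQ'.2, ge_of_tendsto hlim (Eventually.of_forall fun k => hε (φ k))⟩

end Summit.NavierStokesRegularity.NavierStokesRegularity.Theorems.PoloidalWindowDoorPoloidalWindowRigidityEternalCoreScalingCore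

end
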